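import Summits.BirchSwinnertonDyer.Rank1Residual.X11b.BDPRouteWholeClassLarge
import Summits.BirchSwinnertonDyer.Rank1Residual.X11b.TwistTransportTam
import HarnessLib

/-!
# Class X11b, route "BDP + converse-theorem engine + Kolyvagin": the Tamagawa atom (T2) LOCALISED — `p ∣ ∏ c_ℓ` iff some split multiplicative prime `ℓ` has `p ∣ ord_ℓ Δ_min` (cell `b2b-bsdres`, sub-cell `multr1-p2`, gen 9)

HONEST FRAMING (verbatim, cell `b2b-bsdres`): the goal of the cell is to DELETE the
COMBINATION-SHAPED residual classes for ALL analytic-rank `≤ 1` curves over `ℚ` — "full BSD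
formula for every rank `≤ 1` curve in class `C`" assembled STRICTLY from published theorems — so
that the rank-`≤ 1` remainder becomes exactly the CONSTRUCTION-SHAPED classes, which are TYPED
(missing-input Props), NOT attempted; this is not "finishing BSD". Research route `p2` for class
X11b; no claim beyond the stated class; nothing booked; X11b stays CONSTRUCTION-SHAPED. Theorems
only (no definition, no new named fact).

## What this file does

In the whole-class theorems of gens 7–8 (`bsdp_of_classX11b_five_of_typedInputs[_local]`,
`BDPRouteWholeClass[Large].lean`) the typed input (T2) is the Euler-system half of `BSD(E,p)`
(`Typed.MissingUpperBoundAt`) on the sub-population `p ∣ ∏_ℓ c_ℓ(E)` — the pairs where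
Kolyvagin's index bound and the Gross–Zagier/BSD bookkeeping miss each other by the Tamagawa
defect `2·ord_p ∏ c_ℓ` (`BDPRouteTamagawaDefect.lean`). By Kodaira–Néron (Silverman, *ATAEC*
Cor. IV.9.2(d): `c_ℓ ≤ 4` unless the reduction at `ℓ` is split multiplicative, and then
`c_ℓ = ord_ℓ(Δ_min)`; tree theorems `localTamagawaNumber_padic_le_four`,
`localTamagawaNumber_padic_eq_of_split`) this support is, for `p ≥ 5`, EXACTLY the decidable
condition

  `∃ ℓ` prime, `E` split multiplicative at `ℓ` and `p ∣ ord_ℓ(Δ_min(E))`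

(`dvd_tamagawaProduct_iff_exists_split`). So (T2) splits into two local shapes:

* (T2α) `ℓ = p`: `E` is SPLIT multiplicative at `p` and peu ramifié there (`p ∣ ord_p Δ_min`);
* (T2β) `ℓ ≠ p`: a split multiplicative prime `ℓ ≠ p` with `p ∣ ord_ℓ Δ_min`, i.e. a
  multiplicative prime at which `ρ̄_{E,p}` is UNRAMIFIED — the opposite of a (ram) witness
  (`Rank1Residual.Ram` asks `p ∤ ord_ℓ Δ_min`).

`bsdp_of_classX11b_five_of_typedInputs_splitLocal` is gen 8's whole-class theorem with (T2)
replaced by the localised binder "`MissingUpperBoundAt` at the X11b pairs with a split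
multiplicative `ℓ`, `p ∣ ord_ℓ Δ_min`" (it asks for no more than (T2):
`typedUpperSplit_of_typedUpper`), and `not_dvd_tamagawaProduct_of_forall_split` shows that the
Locus condition `p ∤ ∏ c_ℓ` is DECIDED by the valuations of `Δ_min` at the split multiplicative
primes. Census (multr1-p1's `census500k/census_all_500k.tsv.gz`, all 2 267 348 X11b-shape pairs
with `p ≥ 5`, `N < 5·10⁵`; in-window `N < 2·10⁴` after `‖`): the (ram) ∧ `p ∣ ∏c` atom has
61 998 ‖ 2 149 pairs, of which (T2α) 20 824 ‖ 777 (semistable 7 152 ‖ 345) and (T2β) without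
(T2α) 41 174 ‖ 1 372 (semistable 20 372 ‖ 854). The printed road to the Euler-system half on
(T2β) is Jetchev–Skinner–Wan 2017 §7.4.2 (Kolyvagin on the Shimura curve `X_{N⁺,N⁻}` with the
(T2β) primes put into `N⁻`; their Thm. 4.4.1 is printed under (split) `p = v v̄`, so it does not
reach (T2α)) — see `HOME/b2b-bsdres-multr1-p2/SHIMURA-UPPER-HALF-SPEC.md`; NOT claimed here.

CONDITIONAL theorems where typed inputs appear; nothing booked; labels unchanged.

## References

* [SilvermanATAEC1994] J. H. Silverman, *Advanced Topics in the Arithmetic of Elliptic Curves*,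
  GTM 151, Cor. IV.9.2 (b),(d) (p. 340 of the PDF pagination used by the tree's Kodaira–Néron files).
* [JetchevSkinnerWan2017] D. Jetchev, C. Skinner, X. Wan, Camb. J. Math. 5 (2017), §7.4.1–7.4.2
  (arXiv:1512.06894 pp. 30–31), Thm. 4.4.1 (p. 19).
* the references of `BDPRouteWholeClassLarge.lean`.
-/

noncomputable section

open scoped Classical

open WeierstrassCurve NumberField IsDedekindDomain Literature.NumberTheory.EllipticCurves
  Rat.HeightOneSpectrum
  Literature.NumberTheory.EllipticCurves.ModularForms
  Literature.NumberTheory.EllipticCurves.Rank1Residual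
  Literature.NumberTheory.EllipticCurves.Rank1Residual.Typed
  Literature.NumberTheory.EllipticCurves.Wuthrich2014
  Literature.NumberTheory.EllipticCurves.BalakrishnanEtAl2019

namespace Summit.BirchSwinnertonDyer.Rank1Residual.X11b

/-! ### Kodaira–Néron: a prime `p ≥ 5` divides a local Tamagawa number only at a split multiplicative place -/

section Local

variable (ℓ : ℕ) [Fact ℓ.Prime] (X : WeierstrassCurve ℚ_[ℓ]) [X.IsElliptic]

/-- **A prime `p ≥ 5` dividing `c(X/ℚ_ℓ)` forces split multiplicative reduction.** By
Kodaira–Néron `0 < c(X/ℚ_ℓ) ≤ 4` unless the minimal model of `X` has split multiplicative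
reduction (Silverman, *ATAEC* Cor. IV.9.2(d); tree `localTamagawaNumber_padic_le_four`,
`localTamagawaNumber_padic_ne_zero_holds`). [cite: SilvermanATAEC1994, Cor. IV.9.2(d) (PDF p. 340)] -/
theorem hasSplitMultiplicativeReduction_of_five_le_of_dvd_localTamagawaNumber {p : ℕ}
    (hp5 : 5 ≤ p) (h : p ∣ X.localTamagawaNumber ℤ_[ℓ]) :
    (X.minimal ℤ_[ℓ]).HasSplitMultiplicativeReduction ℤ_[ℓ] := by
  by_contra hns
  have h4 := localTamagawaNumber_padic_le_four ℓ X hns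
  have hne := localTamagawaNumber_padic_ne_zero_holds ℓ X
  have hle := Nat.le_of_dvd (Nat.pos_of_ne_zero hne) h
  omega

end Local

/-! ### The global statement: `p ∣ ∏ c_ℓ` iff a split multiplicative `ℓ` has `p ∣ ord_ℓ Δ_min` -/

section Global

variable (W : WeierstrassCurve ℚ) [W.IsElliptic] [W.IsGloballyMinimal]

/-- `ord_v(Δ_min) = ord_ℓ(Δ_min(E))` at a place `v` of `ℤ` above `ℓ`, for a globally minimal
`W/ℚ`: the `ℤ`-place twin of `X11b.ordMinimalDiscriminant_eq_padicValInt` (which is stated at the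
places of `𝓞 ℚ`); both place-indexed exponents are the `ℓ`-adic one
(`WeierstrassCurve.ordMinimalDiscriminant_eq_padic`). [folklore] -/
theorem ordMinimalDiscriminant_int_eq_padicValInt (v : HeightOneSpectrum ℤ) {ℓ : ℕ} [Fact ℓ.Prime]
    (hv : (primesEquiv v : ℕ) = ℓ) :
    W.ordMinimalDiscriminant v = padicValInt ℓ W.minimalDiscriminantInt := by
  set v' : HeightOneSpectrum (𝓞 ℚ) := primesEquiv.symm (primesEquiv v) with hv'def
  have h' : primesEquiv v' = primesEquiv v := Equiv.apply_symm_apply _ _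
  have hv' : (primesEquiv v' : ℕ) = ℓ := by rw [h']; exact hv
  rw [← X11b.ordMinimalDiscriminant_eq_padicValInt W v' hv']
  let e : Nat.Primes → ℕ := fun q =>
    haveI : Fact q.1.Prime := ⟨q.2⟩
    (IsDiscreteValuationRing.addVal ℤ_[q]
      (((W.baseChange ℚ_[q]).minimal ℤ_[q]).integralModel ℤ_[q]).Δ).toNat
  have h1 : W.ordMinimalDiscriminant v = e (primesEquiv v) := W.ordMinimalDiscriminant_eq_padic v
  have h2 : W.ordMinimalDiscriminant v' = e (primesEquiv v') := W.ordMinimalDiscriminant_eq_padic v'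
  rw [h1, h2, h']

/-- **`c_ℓ(E) = ord_ℓ(Δ_min(E))` at a split multiplicative prime** (Kodaira–Néron, Silverman *ATAEC*
Cor. IV.9.2(b),(d); tree `localTamagawaNumber_padic_eq_of_split`), with the exponent written as the
`ℓ`-adic valuation of the global minimal discriminant of the globally minimal model `W`.
[cite: SilvermanATAEC1994, Cor. IV.9.2(d) with (b) (PDF p. 340)] -/
theorem localTamagawaNumber_eq_padicValInt_of_split (v : HeightOneSpectrum ℤ) {ℓ : ℕ}
    [Fact ℓ.Prime] (hv : (primesEquiv v : ℕ) = ℓ)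
    (hs : W.HasSplitMultiplicativeReductionAtPrime ℓ) :
    (W.baseChange ℚ_[ℓ]).localTamagawaNumber ℤ_[ℓ] = padicValInt ℓ W.minimalDiscriminantInt := by
  rw [← ordMinimalDiscriminant_int_eq_padicValInt W v hv]
  -- reduce to `ℓ = primesEquiv v` literally
  have key : ∀ (q : ℕ) (hq : Fact q.Prime), (primesEquiv v : ℕ) = q →
      @WeierstrassCurve.HasSplitMultiplicativeReductionAtPrime W q hq →
      @WeierstrassCurve.localTamagawaNumber ℤ_[q] _ _ _ ℚ_[q] _ _ _ (W.baseChange ℚ_[q]) =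
        W.ordMinimalDiscriminant v := by
    rintro q hq rfl hsq
    haveI : (W.baseChange ℚ_[(primesEquiv v : ℕ)]).IsElliptic :=
      inferInstanceAs (W.map (algebraMap ℚ ℚ_[(primesEquiv v : ℕ)])).IsElliptic
    rw [localTamagawaNumber_padic_eq_of_split _ _ hsq, ← ordMinimalDiscriminant_eq_padic v W]
  exact key ℓ _ hv hs

/-- **(T2) support, the direction `⇐`: a split multiplicative prime `ℓ` with `p ∣ ord_ℓ(Δ_min)`
makes `p ∣ ∏_ℓ c_ℓ(E)`** (any `p`): `c_ℓ = ord_ℓ(Δ_min)` is a factor of the (finite) Tamagawa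
product (`tamagawaProduct_eq_prod`). [cite: SilvermanATAEC1994, Cor. IV.9.2(d) with (b) (PDF p. 340)] -/
theorem dvd_tamagawaProduct_of_split_of_dvd {p ℓ : ℕ} [Fact ℓ.Prime]
    (hs : W.HasSplitMultiplicativeReductionAtPrime ℓ)
    (hd : p ∣ padicValInt ℓ W.minimalDiscriminantInt) : p ∣ W.tamagawaProduct := by
  -- the place of `ℤ` above `ℓ`
  obtain ⟨v, hv⟩ : ∃ v : HeightOneSpectrum ℤ, (primesEquiv v : ℕ) = ℓ :=
    ⟨primesEquiv.symm ⟨ℓ, Fact.out⟩, by rw [Equiv.apply_symm_apply]⟩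
  have hfW : (W.badPlaces ℤ).Finite := W.finite_badPlaces_holds ℤ
  set s : Finset (HeightOneSpectrum ℤ) := insert v hfW.toFinset with hsdef
  have hsW : ∀ w, ¬ W.HasGoodReductionAt w → w ∈ s := fun w hw ↦
    Finset.mem_insert_of_mem (by rw [Set.Finite.mem_toFinset, mem_badPlaces_iff]; exact hw)
  rw [tamagawaProduct_eq_prod W s hsW]
  refine dvd_trans ?_ (Finset.dvd_prod_of_mem _ (Finset.mem_insert_self v _))
  -- the factor at `v` is `c_ℓ = ord_ℓ Δ_min`
  have key : ∀ (q : ℕ) (hq : Fact q.Prime), (primesEquiv v : ℕ) = q →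
      @WeierstrassCurve.HasSplitMultiplicativeReductionAtPrime W q hq →
      p ∣ padicValInt q W.minimalDiscriminantInt →
      p ∣ @WeierstrassCurve.localTamagawaNumber ℤ_[q] _ _ _ ℚ_[q] _ _ _ (W.baseChange ℚ_[q]) := by
    rintro q hq hq' hsq hdq
    rwa [localTamagawaNumber_eq_padicValInt_of_split W v hq' hsq]
  exact key _ _ rfl (hv ▸ hs) (hv ▸ hd)

/-- **(T2) support — `p ∣ ∏_ℓ c_ℓ(E)` iff some split multiplicative prime `ℓ` has
`p ∣ ord_ℓ(Δ_min(E))`, for a prime `p ≥ 5`.** (⇒) write `∏ c_ℓ` as the finite product of the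
`ℓ`-adic local Tamagawa numbers over the bad places (`tamagawaProduct_eq_prod`); the prime `p`
divides one factor `c_ℓ`; `c_ℓ ≤ 4 < p` unless split multiplicative (Kodaira–Néron), and then
`c_ℓ = ord_ℓ Δ_min`. (⇐) `dvd_tamagawaProduct_of_split_of_dvd`.
[cite: SilvermanATAEC1994, Cor. IV.9.2(d) with (b) (PDF p. 340)] -/
theorem dvd_tamagawaProduct_iff_exists_split {p : ℕ} (hp : p.Prime) (hp5 : 5 ≤ p) :
    p ∣ W.tamagawaProduct ↔
      ∃ ℓ : ℕ, ∃ _ : Fact ℓ.Prime, W.HasSplitMultiplicativeReductionAtPrime ℓ ∧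
        p ∣ padicValInt ℓ W.minimalDiscriminantInt := by
  constructor
  · intro hdvd
    have hfW : (W.badPlaces ℤ).Finite := W.finite_badPlaces_holds ℤ
    set s : Finset (HeightOneSpectrum ℤ) := hfW.toFinset with hsdef
    have hsW : ∀ w, ¬ W.HasGoodReductionAt w → w ∈ s := fun w hw ↦ by
      rw [hsdef, Set.Finite.mem_toFinset, mem_badPlaces_iff]; exact hw
    rw [tamagawaProduct_eq_prod W s hsW] at hdvd
    obtain ⟨v, -, hv⟩ := hp.prime.exists_mem_finset_dvd hdvd
    haveI := Fact.mk (primesEquiv v).2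
    haveI : (W.baseChange ℚ_[(primesEquiv v : ℕ)]).IsElliptic :=
      inferInstanceAs (W.map (algebraMap ℚ ℚ_[(primesEquiv v : ℕ)])).IsElliptic
    have hs : W.HasSplitMultiplicativeReductionAtPrime (primesEquiv v : ℕ) :=
      hasSplitMultiplicativeReduction_of_five_le_of_dvd_localTamagawaNumber _ _ hp5 hv
    refine ⟨(primesEquiv v : ℕ), inferInstance, hs, ?_⟩
    rwa [localTamagawaNumber_eq_padicValInt_of_split W v rfl hs] at hv
  · rintro ⟨ℓ, _, hs, hd⟩
    exact dvd_tamagawaProduct_of_split_of_dvd W hs hd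

/-- **The Locus condition `p ∤ ∏ c_ℓ` decided by `Δ_min`**: if every split multiplicative prime
`ℓ` of `E` has `p ∤ ord_ℓ(Δ_min)`, then `p ∤ ∏_ℓ c_ℓ(E)` (`p ≥ 5`). In particular a très-ramifié
pair (`p ∤ ord_p Δ_min`) all of whose other split multiplicative primes are (ram) witnesses lies on
the route's Locus as soon as it has a (ram) prime. [cite: SilvermanATAEC1994, Cor. IV.9.2(d) (PDF p. 340)] -/
theorem not_dvd_tamagawaProduct_of_forall_split {p : ℕ} (hp : p.Prime) (hp5 : 5 ≤ p)
    (h : ∀ (ℓ : ℕ) [Fact ℓ.Prime], W.HasSplitMultiplicativeReductionAtPrime ℓ →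
      ¬ p ∣ padicValInt ℓ W.minimalDiscriminantInt) :
    ¬ p ∣ W.tamagawaProduct := by
  rw [dvd_tamagawaProduct_iff_exists_split W hp hp5]
  rintro ⟨ℓ, _, hs, hd⟩
  exact h ℓ hs hd

end Global

/-! ### Class X11b: the shape of the (T2) atom -/

section ClassLevel

variable (W : WeierstrassCurve ℚ) [W.IsElliptic] [W.IsGloballyMinimal] (p : ℕ) [hp : Fact p.Prime]

/-- **The (T2) atom of X11b has two local shapes.** For an X11b pair `(E,p)` with `p ≥ 5` and
`p ∣ ∏_ℓ c_ℓ(E)`: either (T2α) `E` is SPLIT multiplicative at `p` with `p ∣ ord_p Δ_min` (peu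
ramifié at `p`), or (T2β) there is a split multiplicative prime `ℓ ≠ p` with `p ∣ ord_ℓ Δ_min`
(a multiplicative prime at which `ρ̄_{E,p}` is unramified). Census `N < 5·10⁵` ‖ `N < 2·10⁴`, on
the (ram) ∧ `p ∣ ∏c` atom (61 998 ‖ 2 149 pairs): (T2α) 20 824 ‖ 777, (T2β)∖(T2α) 41 174 ‖ 1 372.
[cite: SilvermanATAEC1994, Cor. IV.9.2(d) with (b) (PDF p. 340)] -/
theorem ClassX11b.tamagawa_atom_shape (_hX : ClassX11b W p) (hp5 : 5 ≤ p)
    (ht : p ∣ W.tamagawaProduct) :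
    (W.HasSplitMultiplicativeReductionAtPrime p ∧ p ∣ padicValInt p W.minimalDiscriminantInt) ∨
      (∃ ℓ : ℕ, ∃ _ : Fact ℓ.Prime, ℓ ≠ p ∧ W.HasSplitMultiplicativeReductionAtPrime ℓ ∧
        p ∣ padicValInt ℓ W.minimalDiscriminantInt) := by
  obtain ⟨ℓ, hℓ, hs, hd⟩ := (dvd_tamagawaProduct_iff_exists_split W hp.out hp5).mp ht
  by_cases hℓp : ℓ = p
  · subst hℓp
    exact Or.inl ⟨hs, hd⟩
  · exact Or.inr ⟨ℓ, hℓ, hℓp, hs, hd⟩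

omit [W.IsElliptic] hp in
/-- **(T2β) read against (ram):** the (T2β) witness is a multiplicative prime `ℓ ≠ p` with
`p ∣ ord_ℓ Δ_min` — never a (ram) witness (`Ram W p` asks for a multiplicative `ℓ ≠ p` with
`p ∤ ord_ℓ Δ_min`); so on (T2β) pairs of the (ram) atom the conductor has at least two
multiplicative primes besides `p`. [folklore] -/
theorem exists_mult_dvd_of_shapeβ
    (h : ∃ ℓ : ℕ, ∃ _ : Fact ℓ.Prime, ℓ ≠ p ∧ W.HasSplitMultiplicativeReductionAtPrime ℓ ∧
      p ∣ padicValInt ℓ W.minimalDiscriminantInt) :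
    ∃ ℓ : ℕ, ∃ _ : Fact ℓ.Prime, ℓ ≠ p ∧ Mult W ℓ ∧ p ∣ padicValInt ℓ W.minimalDiscriminantInt := by
  obtain ⟨ℓ, hℓ, hne, hs, hd⟩ := h
  exact ⟨ℓ, hℓ, hne, hs.hasMultiplicativeReductionAtPrime, hd⟩

omit [W.IsElliptic] in
/-- **(T2α) pairs are peu ramifié at `p`**, hence outside the reach of the très-ramifié
surjectivity theorem `ClassX11b.surj_of_not_dvd` — but on the (ram) atom `Surj` holds anyway
(`surj_of_irr_of_ram`). Recorded for the census dictionary: (T2α) ⊆ {split at `p`} ∩ {`p ∣ ord_p Δ_min`}.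
[folklore] -/
theorem dvd_padicValInt_of_shapeα
    (h : W.HasSplitMultiplicativeReductionAtPrime p ∧ p ∣ padicValInt p W.minimalDiscriminantInt) :
    Mult W p ∧ p ∣ padicValInt p W.minimalDiscriminantInt :=
  ⟨h.1.hasMultiplicativeReductionAtPrime, h.2⟩

end ClassLevel

/-! ### The whole-class theorem with (T2) localised -/

/-- **The localised (T2) binder asks for no more than (T2):** a supplier of
`Typed.MissingUpperBoundAt` on `ClassX11b ∧ 5 ≤ p ∧ p ∣ ∏c_ℓ` supplies it on the X11b pairs with a
split multiplicative `ℓ`, `p ∣ ord_ℓ Δ_min` (`dvd_tamagawaProduct_of_split_of_dvd`). [folklore] -/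
theorem typedUpperSplit_of_typedUpper
    (hU : ∀ (W : WeierstrassCurve ℚ) [W.IsElliptic] [W.IsGloballyMinimal] (p : ℕ) [Fact p.Prime],
      ClassX11b W p → 5 ≤ p → p ∣ W.tamagawaProduct → Typed.MissingUpperBoundAt W p) :
    ∀ (W : WeierstrassCurve ℚ) [W.IsElliptic] [W.IsGloballyMinimal] (p : ℕ) [Fact p.Prime]
      (ℓ : ℕ) [Fact ℓ.Prime], ClassX11b W p → 5 ≤ p → W.HasSplitMultiplicativeReductionAtPrime ℓ →
        p ∣ padicValInt ℓ W.minimalDiscriminantInt → Typed.MissingUpperBoundAt W p :=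
  fun W _ _ p _ _ _ hX hp5 hs hd ↦ hU W p hX hp5 (dvd_tamagawaProduct_of_split_of_dvd W hs hd)

/-- **The (T2) binder recovered from the localised one** (`p ≥ 5`): conversely, a supplier of the
Euler-system half at the X11b pairs with a split multiplicative `ℓ`, `p ∣ ord_ℓ Δ_min`, supplies
(T2) (`dvd_tamagawaProduct_iff_exists_split`). So the two binders are equivalent; the localised one
displays the DECIDABLE support. [cite: SilvermanATAEC1994, Cor. IV.9.2(d) with (b) (PDF p. 340)] -/
theorem typedUpper_of_typedUpperSplit
    (hU : ∀ (W : WeierstrassCurve ℚ) [W.IsElliptic] [W.IsGloballyMinimal] (p : ℕ) [Fact p.Prime]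
      (ℓ : ℕ) [Fact ℓ.Prime], ClassX11b W p → 5 ≤ p → W.HasSplitMultiplicativeReductionAtPrime ℓ →
        p ∣ padicValInt ℓ W.minimalDiscriminantInt → Typed.MissingUpperBoundAt W p) :
    ∀ (W : WeierstrassCurve ℚ) [W.IsElliptic] [W.IsGloballyMinimal] (p : ℕ) [Fact p.Prime],
      ClassX11b W p → 5 ≤ p → p ∣ W.tamagawaProduct → Typed.MissingUpperBoundAt W p := by
  intro W _ _ p hp hX hp5 ht
  obtain ⟨ℓ, hℓ, hs, hd⟩ := (dvd_tamagawaProduct_iff_exists_split W hp.out hp5).mp ht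
  exact hU W p ℓ hX hp5 hs hd

/-- **X11b, whole class, `p ≥ 5`, with (T2) AND (T4) localised.** `BSD(E,p)` for EVERY pair
`(E,p)` of X11b with `p ≥ 5`, from the published facts of gen 8's
`bsdp_of_classX11b_five_of_typedInputs_local` and the typed inputs (T1) STEP L on the surjective
pairs, **(T2♭) the Euler-system half `Typed.MissingUpperBoundAt` at the X11b pairs having a SPLIT
multiplicative prime `ℓ` with `p ∣ ord_ℓ(Δ_min)`** (`ℓ = p`: split and peu ramifié at `p`;
`ℓ ≠ p`: `ρ̄_{E,p}` unramified at the multiplicative prime `ℓ`), (T3) X11a's lower half, (T4′) the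
non-surjective corner localised at `p ∈ {5,7} ∧ p ∣ ord_p Δ_min ∧ ¬Ram`. The (T2) binder of gen 8
(support `p ∣ ∏c_ℓ`) and (T2♭) are interderivable (`typedUpperSplit_of_typedUpper`,
`typedUpper_of_typedUpperSplit`); (T2♭) names the decidable support (Kodaira–Néron).
CONDITIONAL; nothing booked; X11b stays CONSTRUCTION-SHAPED.
[cite: SilvermanATAEC1994, Cor. IV.9.2(d) with (b) (PDF p. 340)] [cite: SilvermanATAEC1994, V.6 Prop. 6.1 (p. 410)]
[cite: JetchevSkinnerWan2017, §7.4.1–7.4.3 (pp. 30–31)] [cite: Skinner2016PacificMC, Thm. C (§1) and footnote 1]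
[cite: Wuthrich2014, Prop. 21 (p. 400)] [cite: BalakrishnanEtAl2019, §1 Thm. 1.2 (arXiv:1711.05846 p. 2)]
[cite: Miller2011LMS, Def. 1.1] -/
theorem bsdp_of_classX11b_five_of_typedInputs_splitLocal
    -- published inputs (named facts of the tree)
    (hGZ : ∀ (N : ℕ) [NeZero N] (W : WeierstrassCurve ℚ) (K : Type) [Field K] [NumberField K],
      gross_zagier N W K)
    (hKo : ∀ (N : ℕ) [NeZero N] (W : WeierstrassCurve ℚ) (K : Type) [Field K] [NumberField K],
      kolyvagin N W K)
    (hB : ∀ (N : ℕ) [NeZero N] (W : WeierstrassCurve ℚ) (K : Type) [Field K] [NumberField K],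
      Kolyvagin1990_padicValNat_card_sha_le N W K)
    (hSk : Skinner2016.thmC_padicValRat_bsd_rank_zero) (hWu : sha_dvd_analyticSha)
    (hGZK : rank_eq_analyticRank_of_analyticRank_le_one) (hmod : hasEntireLFunction_rat)
    (hnf : exists_isNewformOf) (hHL : HoffsteinLuo1997_exists_twist_L_one_ne_zero)
    (hFH : friedbergHoffstein_exists_heegnerField_split_twist_ne_zero)
    (hMaz : mazur_not_dvd_maninConstant_of_odd) (hNS : integral_neronScaling_of_isGloballyMinimal)
    (hBDMTV : thm12_not_le_normalizer_splitCartan)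
    -- (T1) the typed input of the route (STEP L), at the odd-`d_K` Heegner data of surjective X11b pairs
    (hL : ∀ (W : WeierstrassCurve ℚ) [W.IsElliptic] [W.IsGloballyMinimal] (p : ℕ) [Fact p.Prime]
      (N : ℕ) [NeZero N] (K : Type) [Field K] [NumberField K]
      (Dt : ModularParametrizationData W N) (H : HeegnerDatum N (NumberField.discr K)) (ι : K →+* ℂ)
      (P : (W.baseChange K).toAffine.Point),
      ClassX11b W p → Surj W p → W.conductorNorm ℤ = N → IsImaginaryQuadratic K →
      Odd (NumberField.discr K) → ¬ (p : ℤ) ∣ NumberField.discr K → ¬ p ∣ Units.torsionOrder K →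
      SatisfiesHeegnerHypothesis N K →
      (W.quadraticTwist (NumberField.discr K : ℚ)).entireLFunction 1 ≠ 0 →
      WeierstrassCurve.Affine.Point.map ι.toRatAlgHom P = heegnerPointComplex Dt H →
      ¬ (p : ℤ) ∣ Dt.c → IndexLowerBoundAt W p K P)
    -- (T2♭) the Euler-system half at the pairs with a split multiplicative `ℓ`, `p ∣ ord_ℓ Δ_min`
    (hU : ∀ (W : WeierstrassCurve ℚ) [W.IsElliptic] [W.IsGloballyMinimal] (p : ℕ) [Fact p.Prime]
      (ℓ : ℕ) [Fact ℓ.Prime], ClassX11b W p → 5 ≤ p → W.HasSplitMultiplicativeReductionAtPrime ℓ →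
        p ∣ padicValInt ℓ W.minimalDiscriminantInt → Typed.MissingUpperBoundAt W p)
    -- (T3) the main-conjecture half on the rank-0 sister class X11a
    (hX11a : ∀ (Wd : WeierstrassCurve ℚ) [Wd.IsElliptic] [Wd.IsGloballyMinimal] (p : ℕ)
      [Fact p.Prime], ClassX11a Wd p → Typed.MissingLowerBoundAt Wd p)
    -- (T4′) the non-surjective corner, LOCALISED: `p ∈ {5,7}`, `p ∣ ord_p Δ_min`, no (ram) prime
    (hC : ∀ (W : WeierstrassCurve ℚ) [W.IsElliptic] [W.IsGloballyMinimal] (p : ℕ) [Fact p.Prime],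
      ClassX11b W p → ¬ Surj W p → (p = 5 ∨ p = 7) →
        p ∣ padicValInt p W.minimalDiscriminantInt → ¬ Ram W p → Typed.MissingPPartAt W p) :
    ∀ (W : WeierstrassCurve ℚ) [W.IsElliptic] [W.IsGloballyMinimal] (p : ℕ) [Fact p.Prime],
      ClassX11b W p → 5 ≤ p → BSDp W p :=
  bsdp_of_classX11b_five_of_typedInputs_local hGZ hKo hB hSk hWu hGZK hmod hnf hHL hFH hMaz hNS hBDMTV
    hL (typedUpper_of_typedUpperSplit hU) hX11a hC

end Summit.BirchSwinnertonDyer.Rank1Residual.X11b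

end
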